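import Mathlib
import HarnessLib
import Summits.PneNP.PneNP.Theorems.CnfIdealGenLengthRankDefectRepresentationsInsertion

/-!
# Absolute merge for TWO generators against an exact system of any size (crux `RankDefectRepresentations` = stmt-PneNP-18923,
# line `cell-union-merge`; lead g18)

The first case of the lead stub `stub_absoluteMerge` (AMB) beyond its landed `|X| = 2` shadow (bench W26, p727869): the
four-cell system generated by TWO commuting idempotents `E, F` against a complete orthogonal system `Q` of ANY size.
If every union `Q_B` has `rank [E, Q_B] ≤ c` and `rank [F, Q_B] ≤ c`, then there are COMMUTING idempotents `E', F'`, both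
commuting with every `Q_y`, with `rank (E − E') ≤ 16 c` and `rank (F − F') ≤ 73856 c` (`exists_commuting_pair_near`) — constants
ABSOLUTE (independent of `|Y|`, `d`, the field), `Q` untouched.  Consequently every union of the four cells
`E'_a F'_b` (`E'_tt = E'`, `E'_ff = 1 − E'`) is within rank `4 · 73872 c` of the corresponding union of the cells `E_a F_b`
(`fourCells_unions_near`): AMB for `|X| = 4` with `λ = 295488` and `Q' = Q`.

Proof: W26 straightens `E` (`rank (E − E') ≤ 16c`); `F` commutes with `E` exactly, hence with the unions `0, E', 1 − E', 1`
of `{E', 1 − E'}` up to rank `2 · 16 c`; the insertion lemma (`…Insertion.exists_idempotent_commuting_pair`, product system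
`{E', 1−E'} × Q` + joint cut lemma + W26) straightens `F` at cost `16 (144 · 32 + 8) c`.  This is generator-by-generator
insertion; its constant is absolute here only because there are two generators (memo `Lines/cell-union-merge-g18.md` §2:
the drift compounds geometrically in the number of generators).
HONEST FRAMING: negative-lane tool; AMB for arbitrary `|X|` with absolute `λ` stays open; P ≠ NP is not moved; F-N2 is a
FRONTIER formal rung.
-/

set_option linter.dupNamespace false -- `Summit.PneNP.PneNP.…`: summit = sub-problem name (D-0017)

namespace Summit.PneNP.PneNP.Theorems.CnfIdealGenLengthRankDefectRepresentationsTwoGenerators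

open Matrix
open Summit.PneNP.PneNP.Theorems.CnfIdealGenLengthRankDefectRepresentationsAbsoluteMergePair (stub_absoluteMergePair)
open Summit.PneNP.PneNP.Theorems.CnfIdealGenLengthRankDefectRepresentationsInsertion (exists_idempotent_commuting_pair)
open Summit.PneNP.PneNP.Theorems.CnfIdealGenLengthRankDefectRepresentationsPolyOfAbsoluteMergeLevels
  (rank_comm_symm rank_comm_perturb rank_smul_le comm_affine bool_cells_affine rank_sub_triangle)
open Summit.PneNP.PneNP.Theorems.CnfIdealGenLengthRankDefectRepresentationsMergeLowerBound (rank_add_le' rank_sub_le')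

variable {K : Type} [Field K] {d : ℕ}

/-- The two cells of an idempotent are idempotent. -/
theorem twoCells_idem (E : Matrix (Fin d) (Fin d) K) (hE : E * E = E) (b : Bool) :
    (fun b : Bool => bif b then E else 1 - E) b * (fun b : Bool => bif b then E else 1 - E) b = (fun b : Bool => bif b then E else 1 - E) b := by
  cases b
  · show (1 - E) * (1 - E) = 1 - E
    simp only [Matrix.sub_mul, Matrix.mul_sub, Matrix.one_mul, Matrix.mul_one, hE, sub_self, sub_zero]
  · exact hE

/-- The two cells of an idempotent are orthogonal. -/
theorem twoCells_orth (E : Matrix (Fin d) (Fin d) K) (hE : E * E = E) (b b' : Bool) (h : b ≠ b') :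
    (fun b : Bool => bif b then E else 1 - E) b * (fun b : Bool => bif b then E else 1 - E) b' = 0 := by
  cases b <;> cases b'
  · exact absurd rfl h
  · show (1 - E) * E = 0
    rw [Matrix.sub_mul, Matrix.one_mul, hE, sub_self]
  · show E * (1 - E) = 0
    rw [Matrix.mul_sub, Matrix.mul_one, hE, sub_self]
  · exact absurd rfl h

/-- The two cells of an idempotent sum to `1`. -/
theorem twoCells_sum (E : Matrix (Fin d) (Fin d) K) : ∑ b, (fun b : Bool => bif b then E else 1 - E) b = 1 := by
  rw [Fintype.sum_bool]
  show E + (1 - E) = 1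
  abel

/-- Anything commuting with `E` commutes with both cells. -/
theorem twoCells_comm (E G : Matrix (Fin d) (Fin d) K) (h : E * G = G * E) (b : Bool) :
    (fun b : Bool => bif b then E else 1 - E) b * G = G * (fun b : Bool => bif b then E else 1 - E) b := by
  cases b
  · show (1 - E) * G = G * (1 - E)
    rw [Matrix.sub_mul, Matrix.mul_sub, Matrix.one_mul, Matrix.mul_one, h]
  · exact h

/-- A union of the two cells `{E', 1 − E'}` commutes with `F` up to rank `2 · rank (E − E')` when `[F, E] = 0`. -/
theorem rank_comm_twoCells_union_le (E E' F : Matrix (Fin d) (Fin d) K) (hFE : F * E = E * F) (S : Finset Bool) :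
    (F * (∑ b ∈ S, (fun b : Bool => bif b then E' else 1 - E') b) - (∑ b ∈ S, (fun b : Bool => bif b then E' else 1 - E') b) * F).rank ≤ (E - E').rank + (E - E').rank := by
  obtain ⟨α, β, hS⟩ := bool_cells_affine E' S
  change (F * (∑ b ∈ S, (bif b then E' else 1 - E')) - (∑ b ∈ S, (bif b then E' else 1 - E')) * F).rank ≤ _
  rw [hS, rank_comm_symm, comm_affine]
  refine (rank_smul_le _ _).trans ?_
  have h0 : (E * F - F * E).rank = 0 := by rw [hFE, sub_self, Matrix.rank_zero]
  have := rank_comm_perturb E E' F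
  omega

/-- **Two generators against an exact system: absolute merge.**  Commuting idempotents `E, F` whose commutators with every
union of a complete orthogonal system `Q` have rank `≤ c` are within rank `16 c` resp. `73856 c` of commuting idempotents
`E', F'` that commute with every `Q_y`. -/
theorem exists_commuting_pair_near {Y : Type} [Fintype Y] [DecidableEq Y]
    (E F : Matrix (Fin d) (Fin d) K) (Q : Y → Matrix (Fin d) (Fin d) K) (c : ℕ)
    (hE : E * E = E) (hF : F * F = F) (hEF : E * F = F * E)
    (hQi : ∀ y, Q y * Q y = Q y) (hQo : ∀ y y', y ≠ y' → Q y * Q y' = 0) (hQs : ∑ y, Q y = 1)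
    (hEc : ∀ B : Finset Y, (E * (∑ y ∈ B, Q y) - (∑ y ∈ B, Q y) * E).rank ≤ c)
    (hFc : ∀ B : Finset Y, (F * (∑ y ∈ B, Q y) - (∑ y ∈ B, Q y) * F).rank ≤ c) :
    ∃ E' F' : Matrix (Fin d) (Fin d) K,
      E' * E' = E' ∧ F' * F' = F' ∧ E' * F' = F' * E' ∧
      (∀ y, E' * Q y = Q y * E') ∧ (∀ y, F' * Q y = Q y * F') ∧
      (E - E').rank ≤ 16 * c ∧ (F - F').rank ≤ 73856 * c := by
  -- step 1: straighten `E` against `Q` (W26)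
  obtain ⟨E', hE'i, hE'Q, hE'r⟩ := stub_absoluteMergePair K d Y E Q c hE hQi hQo hQs hEc
  -- step 2: insert `F` against the product system `{E', 1 − E'} × Q`
  have hu : ∀ S : Finset Bool,
      (F * (∑ b ∈ S, (fun b : Bool => bif b then E' else 1 - E') b) - (∑ b ∈ S, (fun b : Bool => bif b then E' else 1 - E') b) * F).rank ≤ 32 * c := by
    intro S
    refine (rank_comm_twoCells_union_le E E' F hEF.symm S).trans ?_
    omega
  obtain ⟨F', hF'i, hF'P, hF'Q, hF'r⟩ :=
    exists_idempotent_commuting_pair (fun b : Bool => bif b then E' else 1 - E') Q F (32 * c) c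
      (twoCells_idem E' hE'i) (twoCells_orth E' hE'i) (twoCells_sum E') hQi hQo hQs
      (fun b y => twoCells_comm E' (Q y) (hE'Q y) b) hF hu hFc
  refine ⟨E', F', hE'i, hF'i, ?_, hE'Q, hF'Q, hE'r, hF'r.trans (by omega)⟩
  exact (hF'P true).symm

/-! ## The four-cell form (AMB for `|X| = 4`, `Q' = Q`) -/

/-- Cell by cell, the four cells of `(E', F')` are within `rank (E − E') + rank (F − F')` of those of `(E, F)`. -/
theorem rank_fourCells_sub_le (E F E' F' : Matrix (Fin d) (Fin d) K) (p : Bool × Bool) :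
    (((fun b : Bool => bif b then E else 1 - E) p.1 * (fun b : Bool => bif b then F else 1 - F) p.2) - ((fun b : Bool => bif b then E' else 1 - E') p.1 * (fun b : Bool => bif b then F' else 1 - F') p.2)).rank ≤ (E - E').rank + (F - F').rank := by
  have hcell : ∀ (G G' : Matrix (Fin d) (Fin d) K) (b : Bool), ((fun b : Bool => bif b then G else 1 - G) b - (fun b : Bool => bif b then G' else 1 - G') b).rank ≤ (G - G').rank := by
    intro G G' b
    cases b
    · show ((1 - G) - (1 - G')).rank ≤ _
      have : (1 : Matrix (Fin d) (Fin d) K) - G - (1 - G') = -(G - G') := by abel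
      rw [this, Summit.PneNP.PneNP.Theorems.CnfIdealGenLengthRankDefectRepresentationsMergeLowerBound.rank_neg']
    · exact le_rfl
  have h : ((fun b : Bool => bif b then E else 1 - E) p.1 * (fun b : Bool => bif b then F else 1 - F) p.2) - ((fun b : Bool => bif b then E' else 1 - E') p.1 * (fun b : Bool => bif b then F' else 1 - F') p.2) =
      ((fun b : Bool => bif b then E else 1 - E) p.1 - (fun b : Bool => bif b then E' else 1 - E') p.1) * (fun b : Bool => bif b then F else 1 - F) p.2 + (fun b : Bool => bif b then E' else 1 - E') p.1 * ((fun b : Bool => bif b then F else 1 - F) p.2 - (fun b : Bool => bif b then F' else 1 - F') p.2) := by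
    simp only [Matrix.sub_mul, Matrix.mul_sub]
    abel
  rw [h]
  refine (rank_add_le' _ _).trans (Nat.add_le_add ?_ ?_)
  · exact (Matrix.rank_mul_le_left _ _).trans (hcell E E' p.1)
  · exact (Matrix.rank_mul_le_right _ _).trans (hcell F F' p.2)

/-- **AMB for the four-cell system of two generators, `Q` untouched.**  Under the hypotheses of `exists_commuting_pair_near`,
the four cells `E'_a F'_b` form a complete orthogonal system commuting with every `Q_y`, and EVERY union of them is within
rank `295488 c` of the corresponding union of the cells `E_a F_b`. -/
theorem fourCells_unions_near {Y : Type} [Fintype Y] [DecidableEq Y]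
    (E F : Matrix (Fin d) (Fin d) K) (Q : Y → Matrix (Fin d) (Fin d) K) (c : ℕ)
    (hE : E * E = E) (hF : F * F = F) (hEF : E * F = F * E)
    (hQi : ∀ y, Q y * Q y = Q y) (hQo : ∀ y y', y ≠ y' → Q y * Q y' = 0) (hQs : ∑ y, Q y = 1)
    (hEc : ∀ B : Finset Y, (E * (∑ y ∈ B, Q y) - (∑ y ∈ B, Q y) * E).rank ≤ c)
    (hFc : ∀ B : Finset Y, (F * (∑ y ∈ B, Q y) - (∑ y ∈ B, Q y) * F).rank ≤ c) :
    ∃ E' F' : Matrix (Fin d) (Fin d) K,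
      (∀ p : Bool × Bool, ((fun b : Bool => bif b then E' else 1 - E') p.1 * (fun b : Bool => bif b then F' else 1 - F') p.2) * ((fun b : Bool => bif b then E' else 1 - E') p.1 * (fun b : Bool => bif b then F' else 1 - F') p.2) = ((fun b : Bool => bif b then E' else 1 - E') p.1 * (fun b : Bool => bif b then F' else 1 - F') p.2)) ∧
      (∀ p q : Bool × Bool, p ≠ q → ((fun b : Bool => bif b then E' else 1 - E') p.1 * (fun b : Bool => bif b then F' else 1 - F') p.2) * ((fun b : Bool => bif b then E' else 1 - E') q.1 * (fun b : Bool => bif b then F' else 1 - F') q.2) = 0) ∧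
      ∑ p : Bool × Bool, ((fun b : Bool => bif b then E' else 1 - E') p.1 * (fun b : Bool => bif b then F' else 1 - F') p.2) = 1 ∧
      (∀ (p : Bool × Bool) (y : Y), ((fun b : Bool => bif b then E' else 1 - E') p.1 * (fun b : Bool => bif b then F' else 1 - F') p.2) * Q y = Q y * ((fun b : Bool => bif b then E' else 1 - E') p.1 * (fun b : Bool => bif b then F' else 1 - F') p.2)) ∧
      ∀ A : Finset (Bool × Bool),
        ((∑ p ∈ A, ((fun b : Bool => bif b then E else 1 - E) p.1 * (fun b : Bool => bif b then F else 1 - F) p.2)) - ∑ p ∈ A, ((fun b : Bool => bif b then E' else 1 - E') p.1 * (fun b : Bool => bif b then F' else 1 - F') p.2)).rank ≤ 295488 * c := by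
  obtain ⟨E', F', hE'i, hF'i, hE'F', hE'Q, hF'Q, hE'r, hF'r⟩ :=
    exists_commuting_pair_near E F Q c hE hF hEF hQi hQo hQs hEc hFc
  have hcomm : ∀ a b, (fun b : Bool => bif b then E' else 1 - E') a * (fun b : Bool => bif b then F' else 1 - F') b = (fun b : Bool => bif b then F' else 1 - F') b * (fun b : Bool => bif b then E' else 1 - E') a :=
    fun a b => (twoCells_comm F' ((fun b : Bool => bif b then E' else 1 - E') a) (twoCells_comm E' F' hE'F' a).symm b).symm
  refine ⟨E', F', ?_, ?_, ?_, ?_, ?_⟩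
  · intro p
    exact Summit.PneNP.PneNP.Theorems.CnfIdealGenLengthRankDefectRepresentationsPolyOfAbsoluteMergeLevels.prod_cells_idem
      (fun b : Bool => bif b then E' else 1 - E') (fun b : Bool => bif b then F' else 1 - F') (twoCells_idem E' hE'i) (twoCells_idem F' hF'i) hcomm p
  · intro p q hpq
    exact Summit.PneNP.PneNP.Theorems.CnfIdealGenLengthRankDefectRepresentationsPolyOfAbsoluteMergeLevels.prod_cells_orth
      (fun b : Bool => bif b then E' else 1 - E') (fun b : Bool => bif b then F' else 1 - F') (twoCells_orth E' hE'i) (twoCells_orth F' hF'i) hcomm p q hpq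
  · exact Summit.PneNP.PneNP.Theorems.CnfIdealGenLengthRankDefectRepresentationsPolyOfAbsoluteMergeLevels.prod_cells_sum
      (fun b : Bool => bif b then E' else 1 - E') (fun b : Bool => bif b then F' else 1 - F') (twoCells_sum E') (twoCells_sum F')
  · intro p y
    show (fun b : Bool => bif b then E' else 1 - E') p.1 * (fun b : Bool => bif b then F' else 1 - F') p.2 * Q y = Q y * ((fun b : Bool => bif b then E' else 1 - E') p.1 * (fun b : Bool => bif b then F' else 1 - F') p.2)
    rw [Matrix.mul_assoc, twoCells_comm F' (Q y) (hF'Q y), ← Matrix.mul_assoc, twoCells_comm E' (Q y) (hE'Q y),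
      Matrix.mul_assoc]
  · intro A
    rw [← Finset.sum_sub_distrib]
    refine (Summit.PneNP.PneNP.Theorems.CnfIdealGenLengthRankDefectRepresentationsCutLemmaMaxCut.rank_finsetSum_le A _).trans ?_
    calc ∑ p ∈ A, (((fun b : Bool => bif b then E else 1 - E) p.1 * (fun b : Bool => bif b then F else 1 - F) p.2) - ((fun b : Bool => bif b then E' else 1 - E') p.1 * (fun b : Bool => bif b then F' else 1 - F') p.2)).rank
        ≤ ∑ p ∈ A, ((E - E').rank + (F - F').rank) := Finset.sum_le_sum fun p _ => rank_fourCells_sub_le E F E' F' p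
      _ = A.card * ((E - E').rank + (F - F').rank) := by rw [Finset.sum_const, smul_eq_mul]
      _ ≤ 4 * ((E - E').rank + (F - F').rank) := by
          refine Nat.mul_le_mul_right _ ?_
          calc A.card ≤ (Finset.univ : Finset (Bool × Bool)).card := Finset.card_le_card (Finset.subset_univ A)
            _ = 4 := by simp
      _ ≤ 295488 * c := by omega

end Summit.PneNP.PneNP.Theorems.CnfIdealGenLengthRankDefectRepresentationsTwoGenerators
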